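import Mathlib
import HarnessLib
import Literature.Analysis.FluidPDE.ClassicalSolution
import Literature.Analysis.FluidPDE.LerayHopf
import Literature.Analysis.FluidPDE.SelfSimilar
import Literature.Analysis.FluidPDE.SelfSimilarLiouville
import Literature.Analysis.FluidPDE.LocalTypeI
import Literature.Analysis.FluidPDE.VectorCalculus
import Literature.Analysis.FluidPDE.TypeIAncientMild
import Literature.Analysis.FluidPDE.ChaeWolfRemovingDSS
import Literature.Analysis.FluidPDE.ChaeWolfRemovingDSSProofs
import Literature.Analysis.FluidPDE.ChaeWolfRemovingDSSLimit
import Literature.Analysis.UnboundedOperators.HeatKernel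
import Summits.NavierStokesRegularity.NavierStokesRegularity.Theorems.LocalVelCompTubeDoorLocalPointZoomVelSlices
import Summits.NavierStokesRegularity.NavierStokesRegularity.Theorems.PlaneStrainDoorZoomSpaceTimeDecay
import Summits.NavierStokesRegularity.NavierStokesRegularity.Theorems.LocalSineTubeDoorProfileAlignedWindowRigidityAncient
import Summits.NavierStokesRegularity.NavierStokesRegularity.Theorems.PoloidalWindowDoorPoloidalWindowRigidityStrata
import Summits.NavierStokesRegularity.NavierStokesRegularity.Theorems.PoloidalWindowDoorPoloidalWindowRigidityFlat
import Summits.NavierStokesRegularity.NavierStokesRegularity.Theorems.PoloidalWindowDoorPoloidalWindowRigidityWindow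
import Summits.NavierStokesRegularity.NavierStokesRegularity.Theorems.TypeIDSSLiouvilleConjecture
import Summits.NavierStokesRegularity.NavierStokesRegularity.Theorems.AdaptedFrequencyTangentFlowTransferAncientPressure
import Summits.NavierStokesRegularity.NavierStokesRegularity.Theorems.PeepholeEchoDoorDefs
import Summits.NavierStokesRegularity.NavierStokesRegularity.Theorems.ZoomReturnDoorDefs

/-!
# ZoomReturnDoorWindowLimit — S25 «ZoomReturnDoor» (small echoes near ratio one; removable DSS factors), part 2/4

§1 the SMALL-ECHO WINDOW LIMIT `smallEcho_windowLimit` (Fatou along the tree's velocity zoom with `liminf ≤ ε` in place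
of S23's `= 0`) and K1-small PROVED: `localPointZoomSmallEcho_holds`.

Door family of LADDER-NS N0 (local Type-I window doors S20–S25); THEOREMS-ONLY landing of the nsreg-p1 design
`run/shared/lean/pub/ns-regularity-ideate/ns-regularity-ideate-p1/r24/Sketch25.lean` (ROUND-24.md).  Door T5⁺ «no SMALL
near-one echo»: a space–time local Type-I point whose two-time defect at a ratio in a near-one band is EVENTUALLY `ε`-small on
a window (`ε` fixed before the ratio) is regular; corollary door T6 «restless profile».  Everything conditional is conditional on
the two CLAIMED compactness theorems K-band `BandStability` / K-open `RemovableSetOpen` (Chae–Wolf 2017 §3 engine, tree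
`Literature.Analysis.FluidPDE.ChaeWolf.exists_limit`, run with a convergent factor sequence), which enter as hypotheses.
No route, no items (DIRECTOR-NS standing #32 (2)).  WHAT THIS IS NOT: not a regularity claim; not an attack on
`TypeIDSSLiouville`; the band door is EXACTLY as strong as the graded DSS wall on its band (`removable_of_bandResidue`).
-/

noncomputable section

set_option linter.dupNamespace false

namespace Summit.NavierStokesRegularity.NavierStokesRegularity.Theorems.ZoomReturnDoorWindowLimit

open MeasureTheory Set Function Filter Topology TopologicalSpace Metric
open scoped RealInnerProductSpace NNReal ENNReal Topology Pointwise
open Literature.Analysis Literature.Analysis.FluidPDE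
open Summit.NavierStokesRegularity.NavierStokesRegularity.Theorems.LocalSineTubeDoorProfileAlignedWindowRigidityAncient
open Summit.NavierStokesRegularity.NavierStokesRegularity.Theorems.PoloidalWindowDoorPoloidalWindowRigidityStrata
open Summit.NavierStokesRegularity.NavierStokesRegularity.Theorems.PoloidalWindowDoorPoloidalWindowRigidityFlat
open Summit.NavierStokesRegularity.NavierStokesRegularity.Theorems.PoloidalWindowDoorPoloidalWindowRigidityWindow
open Summit.NavierStokesRegularity.NavierStokesRegularity.Theorems.PeepholeEchoDoorDefs
open Summit.NavierStokesRegularity.NavierStokesRegularity.Theorems.ZoomReturnDoorDefs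

section Core

variable {ν T : ℝ} {u : ℝ → EuclideanSpace ℝ (Fin 3) → EuclideanSpace ℝ (Fin 3)} {p : ℝ → EuclideanSpace ℝ (Fin 3) → ℝ}
  {x₀ : EuclideanSpace ℝ (Fin 3)} {v : ℝ → EuclideanSpace ℝ (Fin 3) → EuclideanSpace ℝ (Fin 3)} {lam : ℕ → ℝ}

/-- **SMALL-ECHO WINDOW LIMIT.**  Along a velocity zoom `(λⱼ, v)` at `(x₀, T)` (rescaled velocities converge pointwise
on every slice; no continuity of the slices of `v` is needed), a two-time `(κ, μ)`-defect EVENTUALLY `ε`-small on `U` leaves, at every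
profile time `s < 0`, `∫_U profileDefect(ν, v, κ, μ, s, y) dy ≤ ε` (Fatou along the zoom times; no hypothesis on `U`). -/
theorem smallEcho_windowLimit (hν : 0 < ν) (hT : 0 < T) (hcl : IsClassicalNSSolutionOn (Ico 0 T) ν 0 u p)
    (hlam : ∀ j, 0 < lam j) (hlam0 : Tendsto lam atTop (𝓝 0))
    (hconv : ∀ s < 0, ∀ y,
      Tendsto (fun j => (lam j / ν) • u (T + lam j ^ 2 * s / ν) (x₀ + lam j • y)) atTop (𝓝 (v s y)))
    {κ μ ε : ℝ} (hκ : 0 < κ) {U : Set (EuclideanSpace ℝ (Fin 3))}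
    (hsmall : DefectEventuallySmall T x₀ u κ μ U ε) {s : ℝ} (hs : s < 0) :
    ∫⁻ y in U, ENNReal.ofReal (profileDefect ν v κ μ s y) ≤ ENNReal.ofReal ε := by
  -- ## zoom times `tⱼ = T + λⱼ² s/ν → T⁻` and their partners `t'ⱼ = T − κ(T − tⱼ) = T + λⱼ² (κs)/ν`
  have hns : 0 < -s := neg_pos.2 hs
  have hκs : κ * s < 0 := mul_neg_of_pos_of_neg hκ hs
  obtain ⟨t, ht⟩ : ∃ t : ℕ → ℝ, ∀ j, t j = T + lam j ^ 2 * s / ν := ⟨_, fun j => rfl⟩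
  have hTt : ∀ j, T - t j = lam j ^ 2 * (-s) / ν := fun j => by rw [ht j]; ring
  have ht' : ∀ j, T - κ * (T - t j) = T + lam j ^ 2 * (κ * s) / ν := fun j => by rw [ht j]; ring
  have hc : ∀ j, 0 < lam j ^ 2 * (-s) / ν := fun j => div_pos (mul_pos (pow_pos (hlam j) 2) hns) hν
  have hc0 : Tendsto (fun j => lam j ^ 2 * (-s) / ν) atTop (𝓝 0) := by
    simpa using ((hlam0.pow 2).mul_const (-s)).div_const ν
  have htT : Tendsto t atTop (𝓝[<] T) := by
    refine tendsto_nhdsWithin_iff.2 ⟨?_, Eventually.of_forall fun j => ?_⟩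
    · have h1 : Tendsto (fun j => T - lam j ^ 2 * (-s) / ν) atTop (𝓝 (T - 0)) :=
        tendsto_const_nhds.sub hc0
      rw [sub_zero] at h1
      refine h1.congr fun j => ?_
      rw [ht j]; ring
    · show t j < T
      have h1 := hc j
      rw [← hTt j] at h1
      linarith
  have htT' : Tendsto (fun j => T - κ * (T - t j)) atTop (𝓝[<] T) := by
    refine tendsto_nhdsWithin_iff.2 ⟨?_, Eventually.of_forall fun j => ?_⟩
    · have h1 : Tendsto (fun j => T - κ * (lam j ^ 2 * (-s) / ν)) atTop (𝓝 (T - κ * 0)) :=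
        tendsto_const_nhds.sub (hc0.const_mul κ)
      rw [mul_zero, sub_zero] at h1
      refine h1.congr fun j => ?_
      rw [hTt j]
    · show T - κ * (T - t j) < T
      have h1 := mul_pos hκ (hc j)
      rw [← hTt j] at h1
      linarith
  have hev : ∀ᶠ j in atTop, t j ∈ Set.Ioo 0 T ∧ T - κ * (T - t j) ∈ Set.Ioo 0 T :=
    (htT.eventually (Ioo_mem_nhdsLT hT)).and (htT'.eventually (Ioo_mem_nhdsLT hT))
  obtain ⟨j₀, hj₀⟩ := eventually_atTop.1 hev
  have hshift : Tendsto (fun j : ℕ => j + j₀) atTop atTop := tendsto_add_atTop_nat j₀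
  have hsmallj : ∀ᶠ j in atTop,
      ∫⁻ y in U, ENNReal.ofReal (twoTimeDefect T x₀ u κ μ (t (j + j₀)) y) ≤ ENNReal.ofReal ε :=
    (htT.comp hshift).eventually hsmall
  -- ## the similarity scale along the zoom: `√(T − tⱼ) = λⱼ σ`, `σ = √(−s)/√ν`
  set σ : ℝ := Real.sqrt (-s) / Real.sqrt ν with hσ
  have hσpos : 0 < σ := div_pos (Real.sqrt_pos.2 hns) (Real.sqrt_pos.2 hν)
  have hsq : ∀ j, Real.sqrt (T - t j) = lam j * σ := by
    intro j
    rw [hTt j, hσ, Real.sqrt_div' _ hν.le, Real.sqrt_mul (pow_nonneg (hlam j).le 2),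
      Real.sqrt_sq (hlam j).le]
    ring
  set W : ℕ → EuclideanSpace ℝ (Fin 3) → EuclideanSpace ℝ (Fin 3) := fun j y =>
    Real.sqrt (T - t (j + j₀)) • u (t (j + j₀)) (x₀ + Real.sqrt (T - t (j + j₀)) • y) with hWdef
  have hW : ∀ (j : ℕ) (y : EuclideanSpace ℝ (Fin 3)), W j y =
      (σ * ν) • ((lam (j + j₀) / ν) • u (T + lam (j + j₀) ^ 2 * s / ν)
        (x₀ + lam (j + j₀) • (σ • y))) := by
    intro j y
    simp only [hWdef, hsq (j + j₀), smul_smul]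
    rw [ht (j + j₀)]
    congr 1
    field_simp
  set W' : ℕ → EuclideanSpace ℝ (Fin 3) → EuclideanSpace ℝ (Fin 3) := fun j y =>
    (μ * Real.sqrt (T - t (j + j₀))) • u (T - κ * (T - t (j + j₀)))
      (x₀ + (μ * Real.sqrt (T - t (j + j₀))) • y) with hW'def
  have hW' : ∀ (j : ℕ) (y : EuclideanSpace ℝ (Fin 3)), W' j y =
      (μ * σ * ν) • ((lam (j + j₀) / ν) • u (T + lam (j + j₀) ^ 2 * (κ * s) / ν)
        (x₀ + lam (j + j₀) • ((μ * σ) • y))) := by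
    intro j y
    simp only [hW'def, hsq (j + j₀), smul_smul]
    rw [ht' (j + j₀)]
    congr 1
    · field_simp
    · congr 2
      ring
  -- ## the limit defect in window coordinates
  set Hs : EuclideanSpace ℝ (Fin 3) → ℝ := fun y =>
    ‖(σ * ν) • v s (σ • y) - (μ * σ * ν) • v (κ * s) ((μ * σ) • y)‖ with hHsdef
  have hconvW : ∀ y, Tendsto (fun j => W j y) atTop (𝓝 ((σ * ν) • v s (σ • y))) := by
    intro y
    have h := ((hconv s hs (σ • y)).comp hshift).const_smul (σ * ν)
    exact h.congr fun j => (hW j y).symm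
  have hconvW' : ∀ y, Tendsto (fun j => W' j y) atTop (𝓝 ((μ * σ * ν) • v (κ * s) ((μ * σ) • y))) := by
    intro y
    have h := ((hconv (κ * s) hκs ((μ * σ) • y)).comp hshift).const_smul (μ * σ * ν)
    exact h.congr fun j => (hW' j y).symm
  have hconvH : ∀ y, Tendsto (fun j => ‖W j y - W' j y‖) atTop (𝓝 (Hs y)) := fun y =>
    ((hconvW y).sub (hconvW' y)).norm
  -- measurability of the window fields: `u(tⱼ)`, `u(t'ⱼ)` are smooth for the shifted times
  have hmem : ∀ j, t (j + j₀) ∈ Set.Ico 0 T := fun j =>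
    ⟨((hj₀ (j + j₀) (Nat.le_add_left _ _)).1).1.le, ((hj₀ (j + j₀) (Nat.le_add_left _ _)).1).2⟩
  have hmem' : ∀ j, T - κ * (T - t (j + j₀)) ∈ Set.Ico 0 T := fun j =>
    ⟨((hj₀ (j + j₀) (Nat.le_add_left _ _)).2).1.le, ((hj₀ (j + j₀) (Nat.le_add_left _ _)).2).2⟩
  have hφ : ∀ c : ℝ, Continuous fun y : EuclideanSpace ℝ (Fin 3) => x₀ + c • y :=
    fun c => continuous_const.add (continuous_const_smul _)
  have hWc : ∀ j, Continuous (W j) := fun j => by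
    show Continuous fun y => Real.sqrt (T - t (j + j₀)) • u (t (j + j₀)) (x₀ + Real.sqrt (T - t (j + j₀)) • y)
    exact ((hcl.contDiff_velocity (hmem j)).continuous.comp (hφ _)).const_smul (Real.sqrt (T - t (j + j₀)))
  have hW'c : ∀ j, Continuous (W' j) := fun j => by
    show Continuous fun y => (μ * Real.sqrt (T - t (j + j₀))) • u (T - κ * (T - t (j + j₀)))
      (x₀ + (μ * Real.sqrt (T - t (j + j₀))) • y)
    exact ((hcl.contDiff_velocity (hmem' j)).continuous.comp (hφ _)).const_smul (μ * Real.sqrt (T - t (j + j₀)))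
  have hFjc : ∀ j, Continuous fun y => ‖W j y - W' j y‖ := fun j => ((hWc j).sub (hW'c j)).norm
  have hdefect : ∀ j y, twoTimeDefect T x₀ u κ μ (t (j + j₀)) y = ‖W j y - W' j y‖ := fun j y => rfl
  -- ## FATOU: the limit defect integrates to at most `ε` on the window
  set g : EuclideanSpace ℝ (Fin 3) → ℝ≥0∞ := fun y => ENNReal.ofReal (Hs y) with hg
  have hgjm : ∀ j, Measurable fun y => ENNReal.ofReal ‖W j y - W' j y‖ :=
    fun j => (ENNReal.continuous_ofReal.comp (hFjc j)).measurable
  have hptw : ∀ y, Tendsto (fun j => ENNReal.ofReal ‖W j y - W' j y‖) atTop (𝓝 (g y)) :=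
    fun y => ENNReal.tendsto_ofReal (hconvH y)
  have hFatou : ∫⁻ y in U, liminf (fun j => ENNReal.ofReal ‖W j y - W' j y‖) atTop ≤
      liminf (fun j => ∫⁻ y in U, ENNReal.ofReal ‖W j y - W' j y‖) atTop :=
    lintegral_liminf_le' (fun j => (hgjm j).aemeasurable)
  have hlim : (fun y => liminf (fun j => ENNReal.ofReal ‖W j y - W' j y‖) atTop) = g :=
    funext fun y => (hptw y).liminf_eq
  have hsmallW : ∀ᶠ j in atTop, (∫⁻ y in U, ENNReal.ofReal ‖W j y - W' j y‖) ≤ ENNReal.ofReal ε := by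
    filter_upwards [hsmallj] with j hj
    simpa only [hdefect] using hj
  have hlimle : liminf (fun j => ∫⁻ y in U, ENNReal.ofReal ‖W j y - W' j y‖) atTop ≤ ENNReal.ofReal ε :=
    liminf_le_of_frequently_le' hsmallW.frequently
  rw [hlim] at hFatou
  have hgoal : ∫⁻ y in U, g y ≤ ENNReal.ofReal ε := hFatou.trans hlimle
  simpa only [hg, hHsdef, profileDefect, hσ] using hgoal

end Core

/-- **K1-small holds** (tree `localPointZoomVelSlices` = velocity zoom with the local space–time Type-I
bound passing to the decay `M/ν` (`hasTypeIDecay_of_zoom`) and `smallEcho_windowLimit`). -/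
theorem localPointZoomSmallEcho_holds : LocalPointZoomSmallEcho := by
  intro ν T hν hT u p hcl hLH hdec x₀ ρ M hρ hM hnot
  obtain ⟨C, v, lam, hlam, hlam0, ⟨hrate, hcont, hmild, hdiv⟩, hsing, hconv⟩ :=
    Summit.NavierStokesRegularity.NavierStokesRegularity.Theorems.LocalVelCompTubeDoorLocalPointZoomVelSlices.localPointZoomVelSlices
      ν T hν hT u p hcl hLH hdec x₀ ρ M hρ
      (Summit.NavierStokesRegularity.NavierStokesRegularity.Theorems.PlaneStrainDoorZoomSpaceTimeDecay.timeTypeI_of_spaceTimeTypeI hM)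
      hnot
  have hdecay : HasTypeIDecay (M / ν) v :=
    Summit.NavierStokesRegularity.NavierStokesRegularity.Theorems.PlaneStrainDoorZoomSpaceTimeDecay.hasTypeIDecay_of_zoom
      hν hT hρ hlam hlam0 hM hconv
  exact ⟨C, v, ⟨hrate, hcont, hmild, hdiv⟩, hdecay, hsing, fun κ μ ε hκ U hsmall s hs =>
    smallEcho_windowLimit hν hT hcl hlam hlam0 hconv hκ hsmall hs⟩

end Summit.NavierStokesRegularity.NavierStokesRegularity.Theorems.ZoomReturnDoorWindowLimit
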